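import Literature.Computability.AlgebraicComplexity.BurgisserTransferProofs

/-!
# LangWeilTransfer, support item `TransferGlue` (stmt-ValiantsHypothesis-6379) — size bookkeeping

Route `LangWeilTransfer` of `ValiantsHypothesis`, support item `TransferGlue`. The pure arithmetic of
the final bound of Theorem T: with `β = B + T + m + log₂ d + log₂ log₂ w + log₂ t + 2` and
`s = (a₁+1) β²`, the degree/weight data delivered by `TameResolution` (exponent `a₁`), the size of
`GoodReduction`'s exceptional set (exponent `a₂`) and the Lang–Weil threshold (exponent `a₃`) are all
`≤ 2^{O(s)}`, so a prime `p ≤ 2^{2 log₂(threshold + #bad + 2) + 6}` (Chebyshev prime picking) raised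
to the residue degree `f' ≤ B` satisfies `p^{f'} ≤ 2^{β^{a}}` with `a = 24(a₁+1)(a₂+a₃+1)+3`
(`final_bound`). Honest framing: bookkeeping inside a dormant route whose cruxes are open; nothing
here bears on VP ≠ VNP.
-/

-- the summit and the problem share the name `ValiantsHypothesis` (D-0017 single-conjunct layout)
set_option linter.dupNamespace false

namespace Summit.ValiantsHypothesis.ValiantsHypothesis.Theorems.LangWeilTransfer

-- `d + 2 ≤ 2^{log₂ d + 2}` is the tree's
-- `Literature.Computability.AlgebraicComplexity.add_two_le_two_pow_log` (BurgisserTransferProofs).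
open Literature.Computability.AlgebraicComplexity (add_two_le_two_pow_log)

/-- `x + 1 ≤ 2^e` once `x ≤ 2^{e'}` and `e' + 1 ≤ e`. -/
theorem succ_le_two_pow {x e e' : ℕ} (hx : x ≤ 2 ^ e') (he : e' + 1 ≤ e) : x + 1 ≤ 2 ^ e := by
  have h1 : 1 ≤ 2 ^ e' := Nat.one_le_two_pow
  have h2 : 2 ^ (e' + 1) ≤ 2 ^ e := Nat.pow_le_pow_right two_pos he
  have h3 : 2 ^ (e' + 1) = 2 ^ e' * 2 := by rw [← pow_succ]
  omega

/-- **The final size bound of Theorem T** (pure arithmetic). Inputs: the prime `p ≥ 2` with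
`p ≤ 2^{2 log₂(X₀ + #bad' + 2) + 6}`, residue degree `f' ≤ B`, `r ≤ m`, the degree / log-weight
bounds `Δ = (d+2)^{a₁(m+1)}`, `Δ·Λ` of the resolution, the two prime-divisor counts `c₁, c₂ ≤ Δ Λ`,
GoodReduction's `#bad ≤ a₂((B+1)(r+1)(deg Q+1)(log₂ wt Q+1))^{a₂}`, and the threshold
`X₀ ≤ 2^T + a₃ (Δ+1)^{a₃} (Δ+1)^{a₃}`. Output: `p^{f'} ≤ 2^{β^{24(a₁+1)(a₂+a₃+1)+3}}`. -/
theorem final_bound {a₁ a₂ a₃ B T m d w t r f' p degQ lwQ c₁ c₂ cbad X₀ : ℕ}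
    (hp : 2 ≤ p) (hf'B : f' ≤ B) (hr : r ≤ m)
    (hdegQ : degQ ≤ (d + 2) ^ (a₁ * (m + 1)))
    (hlwQ : lwQ ≤ (d + 2) ^ (a₁ * (m + 1)) * (Nat.log 2 w + Nat.log 2 t + 2) ^ a₁)
    (hc₁ : c₁ ≤ (d + 2) ^ (a₁ * (m + 1)) * (Nat.log 2 w + Nat.log 2 t + 2) ^ a₁)
    (hc₂ : c₂ ≤ (d + 2) ^ (a₁ * (m + 1)) * (Nat.log 2 w + Nat.log 2 t + 2) ^ a₁)
    (hcbad : cbad ≤ a₂ * ((B + 1) * (r + 1) * (degQ + 1) * (lwQ + 1)) ^ a₂)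
    (hX₀ : X₀ ≤ 2 ^ T +
      a₃ * ((d + 2) ^ (a₁ * (m + 1)) + 1) ^ a₃ * ((d + 2) ^ (a₁ * (m + 1)) + 1) ^ a₃)
    (hple : p ≤ 2 ^ (2 * Nat.log 2 (X₀ + (cbad + c₁ + c₂) + 2) + 6)) :
    p ^ f' ≤ 2 ^ ((B + T + m + Nat.log 2 d + Nat.log 2 (Nat.log 2 w) + Nat.log 2 t + 2) ^
      (24 * (a₁ + 1) * (a₂ + a₃ + 1) + 3)) := by
  -- names
  obtain ⟨β, hβ⟩ : ∃ β, β = B + T + m + Nat.log 2 d + Nat.log 2 (Nat.log 2 w) + Nat.log 2 t + 2 :=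
    ⟨_, rfl⟩
  obtain ⟨Δ, hΔ⟩ : ∃ Δ, Δ = (d + 2) ^ (a₁ * (m + 1)) := ⟨_, rfl⟩
  obtain ⟨Λ, hΛ⟩ : ∃ Λ, Λ = (Nat.log 2 w + Nat.log 2 t + 2) ^ a₁ := ⟨_, rfl⟩
  obtain ⟨s, hs⟩ : ∃ s, s = (a₁ + 1) * β ^ 2 := ⟨_, rfl⟩
  obtain ⟨μ, hμ⟩ : ∃ μ, μ = 2 * Nat.log 2 (X₀ + (cbad + c₁ + c₂) + 2) + 6 := ⟨_, rfl⟩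
  rw [← hβ]
  rw [← hΔ, ← hΛ] at hlwQ hc₁ hc₂
  rw [← hΔ] at hdegQ hX₀
  rw [← hμ] at hple
  have hβ2 : 2 ≤ β := by omega
  have hβsq : β ^ 2 = β * β := sq β
  have hβ1 : 1 ≤ β ^ 2 := Nat.one_le_pow _ _ (by omega)
  have hββ : β ≤ β ^ 2 := by rw [hβsq]; exact Nat.le_mul_of_pos_left β (by omega)
  have hsexp : s = a₁ * β ^ 2 + β ^ 2 := by rw [hs]; ring
  have hβs : β ≤ s := by omega
  have hs1 : 1 ≤ s := by omega
  have h2pow : ∀ n : ℕ, n ≤ 2 ^ n := fun n => (Nat.lt_two_pow_self).le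
  -- `Δ ≤ 2^{a₁ β²}`, `Δ + 1 ≤ 2^s`
  have hΔle : Δ ≤ 2 ^ (a₁ * β ^ 2) := by
    have h1 : Nat.log 2 d + 2 ≤ β := by omega
    have h2 : m + 1 ≤ β := by omega
    calc Δ = (d + 2) ^ (a₁ * (m + 1)) := hΔ
      _ ≤ (2 ^ (Nat.log 2 d + 2)) ^ (a₁ * (m + 1)) :=
          Nat.pow_le_pow_left (add_two_le_two_pow_log d) _
      _ = 2 ^ ((Nat.log 2 d + 2) * (a₁ * (m + 1))) := by rw [← pow_mul]
      _ ≤ 2 ^ (a₁ * β ^ 2) := Nat.pow_le_pow_right two_pos ?_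
    calc (Nat.log 2 d + 2) * (a₁ * (m + 1)) ≤ β * (a₁ * β) :=
          Nat.mul_le_mul h1 (Nat.mul_le_mul_left _ h2)
      _ = a₁ * β ^ 2 := by ring
  have hΔ1 : Δ + 1 ≤ 2 ^ s := succ_le_two_pow hΔle (by omega)
  -- `Λ ≤ 2^{a₁ β}`, `Δ Λ + 1 ≤ 2^{2s}`
  have hbase : Nat.log 2 w + Nat.log 2 t + 2 ≤ 2 ^ β := by
    have h1 : Nat.log 2 w < 2 ^ (Nat.log 2 (Nat.log 2 w) + 1) :=
      Nat.lt_pow_succ_log_self one_lt_two _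
    have h2 : 2 ^ (Nat.log 2 (Nat.log 2 w) + 1) ≤ 2 ^ (β - 1) :=
      Nat.pow_le_pow_right two_pos (by omega)
    have h3 : β - 1 < 2 ^ (β - 1) := Nat.lt_two_pow_self
    have h4 : 2 ^ β = 2 ^ (β - 1) * 2 := by rw [← pow_succ]; congr 1; omega
    omega
  have hΛle : Λ ≤ 2 ^ (a₁ * β) := by
    calc Λ = (Nat.log 2 w + Nat.log 2 t + 2) ^ a₁ := hΛ
      _ ≤ (2 ^ β) ^ a₁ := Nat.pow_le_pow_left hbase _
      _ = 2 ^ (a₁ * β) := by rw [← pow_mul, mul_comm]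
  have hΔΛ1 : Δ * Λ + 1 ≤ 2 ^ (2 * s) := by
    refine succ_le_two_pow (e' := a₁ * β ^ 2 + a₁ * β) ?_ ?_
    · rw [pow_add]; exact Nat.mul_le_mul hΔle hΛle
    · have : a₁ * β ≤ a₁ * β ^ 2 := Nat.mul_le_mul_left _ hββ
      omega
  have hβ2s : β ≤ 2 ^ s := hβs.trans (h2pow s)
  -- products `s a₂`, `s a₃`
  obtain ⟨u, hu⟩ : ∃ u, u = s * a₂ := ⟨_, rfl⟩
  obtain ⟨v, hv⟩ : ∃ v, v = s * a₃ := ⟨_, rfl⟩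
  have hua : a₂ ≤ u := by rw [hu]; exact Nat.le_mul_of_pos_left a₂ (by omega)
  have hva : a₃ ≤ v := by rw [hv]; exact Nat.le_mul_of_pos_left a₃ (by omega)
  have hu5 : 5 * s * a₂ = 5 * u := by rw [hu]; ring
  -- GoodReduction's exceptional set
  have hcbad' : cbad ≤ 2 ^ (6 * u) := by
    have h1 : (B + 1) * (r + 1) * (degQ + 1) * (lwQ + 1) ≤ 2 ^ (5 * s) := by
      have e1 : B + 1 ≤ 2 ^ s := le_trans (by omega) hβ2s
      have e2 : r + 1 ≤ 2 ^ s := le_trans (by omega) hβ2s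
      have e3 : degQ + 1 ≤ 2 ^ s := le_trans (by omega) hΔ1
      have e4 : lwQ + 1 ≤ 2 ^ (2 * s) := le_trans (by omega) hΔΛ1
      calc (B + 1) * (r + 1) * (degQ + 1) * (lwQ + 1) ≤ 2 ^ s * 2 ^ s * 2 ^ s * 2 ^ (2 * s) :=
            Nat.mul_le_mul (Nat.mul_le_mul (Nat.mul_le_mul e1 e2) e3) e4
        _ = 2 ^ (5 * s) := by rw [← pow_add, ← pow_add, ← pow_add]; ring_nf
    calc cbad ≤ a₂ * ((B + 1) * (r + 1) * (degQ + 1) * (lwQ + 1)) ^ a₂ := hcbad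
      _ ≤ 2 ^ a₂ * (2 ^ (5 * s)) ^ a₂ := Nat.mul_le_mul (h2pow a₂) (Nat.pow_le_pow_left h1 _)
      _ = 2 ^ (a₂ + 5 * s * a₂) := by rw [← pow_mul, ← pow_add]
      _ ≤ 2 ^ (6 * u) := Nat.pow_le_pow_right two_pos (by rw [hu5]; omega)
  -- the threshold
  have hX₀' : X₀ ≤ 2 ^ s + 2 ^ (3 * v) := by
    have h1 : a₃ * (Δ + 1) ^ a₃ * (Δ + 1) ^ a₃ ≤ 2 ^ (3 * v) := by
      calc a₃ * (Δ + 1) ^ a₃ * (Δ + 1) ^ a₃ ≤ 2 ^ a₃ * (2 ^ s) ^ a₃ * (2 ^ s) ^ a₃ :=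
            Nat.mul_le_mul (Nat.mul_le_mul (h2pow a₃) (Nat.pow_le_pow_left hΔ1 _))
              (Nat.pow_le_pow_left hΔ1 _)
        _ = 2 ^ (a₃ + s * a₃ + s * a₃) := by rw [← pow_mul, ← pow_add, ← pow_add]
        _ ≤ 2 ^ (3 * v) := Nat.pow_le_pow_right two_pos (by rw [hv]; omega)
    have h2 : 2 ^ T ≤ 2 ^ s := Nat.pow_le_pow_right two_pos (le_trans (by omega) hβs)
    exact hX₀.trans (Nat.add_le_add h2 h1)
  -- everything `≤ 2^{6n}`, `n = s (a₂ + a₃ + 1) = u + v + s`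
  obtain ⟨n, hn⟩ : ∃ n, n = s * (a₂ + a₃ + 1) := ⟨_, rfl⟩
  have hnexp : n = u + v + s := by rw [hn, hu, hv]; ring
  have e0 : (2 : ℕ) ^ s ≤ 2 ^ (6 * n) := Nat.pow_le_pow_right two_pos (by omega)
  have e1 : (2 : ℕ) ^ (3 * v) ≤ 2 ^ (6 * n) := Nat.pow_le_pow_right two_pos (by omega)
  have e2 : (2 : ℕ) ^ (6 * u) ≤ 2 ^ (6 * n) := Nat.pow_le_pow_right two_pos (by omega)
  have e3 : (2 : ℕ) ^ (2 * s) ≤ 2 ^ (6 * n) := Nat.pow_le_pow_right two_pos (by omega)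
  have e4 : (2 : ℕ) ≤ 2 ^ (6 * n) := by
    have := Nat.pow_le_pow_right two_pos (show 1 ≤ 6 * n by omega)
    simpa using this
  have hc₁' : c₁ ≤ 2 ^ (2 * s) := le_trans (le_trans hc₁ (Nat.le_succ _)) hΔΛ1
  have hc₂' : c₂ ≤ 2 ^ (2 * s) := le_trans (le_trans hc₂ (Nat.le_succ _)) hΔΛ1
  have htot : X₀ + (cbad + c₁ + c₂) + 2 ≤ 2 ^ (6 * n + 3) := by
    have : (2 : ℕ) ^ (6 * n + 3) = 2 ^ (6 * n) * 8 := by rw [pow_add]; norm_num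
    omega
  have hlog : Nat.log 2 (X₀ + (cbad + c₁ + c₂) + 2) ≤ 6 * n + 3 := by
    have := Nat.log_mono_right (b := 2) htot
    rwa [Nat.log_pow one_lt_two] at this
  -- `μ B ≤ β^{C₀ + 3}`
  obtain ⟨C₀, hC₀⟩ : ∃ C₀, C₀ = 24 * (a₁ + 1) * (a₂ + a₃ + 1) := ⟨_, rfl⟩
  rw [← hC₀]
  have hμle : μ ≤ 24 * n := by omega
  have hC₀β : C₀ ≤ β ^ C₀ := (h2pow C₀).trans (Nat.pow_le_pow_left hβ2 _)
  have hexp : μ * B ≤ β ^ (C₀ + 3) := by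
    calc μ * B ≤ (24 * n) * β := Nat.mul_le_mul hμle (by omega)
      _ = C₀ * β ^ 3 := by rw [hn, hs, hC₀]; ring
      _ ≤ β ^ C₀ * β ^ 3 := Nat.mul_le_mul_right _ hC₀β
      _ = β ^ (C₀ + 3) := by rw [← pow_add]
  calc p ^ f' ≤ p ^ B := Nat.pow_le_pow_right (by omega) hf'B
    _ ≤ (2 ^ μ) ^ B := Nat.pow_le_pow_left hple _
    _ = 2 ^ (μ * B) := by rw [← pow_mul]
    _ ≤ 2 ^ (β ^ (C₀ + 3)) := Nat.pow_le_pow_right two_pos hexp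

end Summit.ValiantsHypothesis.ValiantsHypothesis.Theorems.LangWeilTransfer
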